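import Literature.NumberTheory.EllipticCurves.ZpExtensionEisensteinPiLevelH2BoundProofs
import HarnessLib

/-!
# `#H²(K_w, gr_w(T/π^iT)) ≤ p^{p^s}`: the uniform `H²`-bound on the graded line of Howard's `π`-adic Eisenstein levels at a
# place above `p` (theorems only — no definition, no named fact, no instance, no `sorry`)

Topic `NumberTheory/EllipticCurves` (cell `pub/bsd-print-x9`, shared μ-crux `MuInequalityCoherentPairOfPrint`, registered stub
`stub_h5bAtS`; brick (F4c-3)(iii) of the uniform-`ι` road; sequel of `ZpExtensionEisensteinPiLevelH2BoundProofs` (the plus line)).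

B. Howard, Compositio Math. 140 (2004), Lemma 3.2.7 (arXiv:1202.6340 p. 16 L150–156) and §3.1 (`gr_v = T/Fil_v`).  For the curve's
`π`-adic refinement datum `D`, an ordinary datum `Φ` at `w ∣ p` on the torsion tower with an ADAPTED BASIS `P₀, Q₀` of `E[p^k]`
at the host level `k = host i` (`Fil_w E[p^k] = ℤ P₀`, `g₀ Q₀ ≡ λ₂ Q₀ mod Fil_w`), `g₀ ∈ Γ_{K_w}` with `κ(g₀) = p^s` (`p^s < m`)
acting on `μ_{p^k}` by an integer `c` prime to `p`:

* **`WeierstrassCurve.natCard_two_piLevel_quotient_le`** — **`H²(K_w, Level i ⧸ piFil i)` is finite of order `≤ p^{p^s}`**: the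
  graded piece is the `S_𝔮`-line through the class of `[1 ⊗ Q₀]`, on which `g₀` acts by `μ₂ = λ₂·(1+T)^{p^s}`; then as for the
  plus line (scalar dichotomy `(μ₂ − c)·ν = [T]^{p^s}`, `natCard_two_le_natCard_quotient_of_mu_apply_eq_smul`, the surjection
  `S_𝔮 ⧸ (T^{p^s}) ↠ gr ⧸ T^{p^s}·gr`, `natCard_quotient_span_mk_X_pow_eq`).

With `natCard_two_piFil_le` this gives `#H²(K_w, Level i) ≤ p^{2p^s}` through `0 → piFil i → Level i → gr → 0` (next file).
No summit statement is proved; BSD is not proved by any of this.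

References: [Howard2004HeegnerKolyvagin] Lemma 3.2.7, §3.1, Def. 1.1.3, proof of Thm. 2.2.10; [MilneADT2006] I Cor. 2.3;
[GreenbergLNM1716] §2 and proof of Prop. 4.15; [Washington1997] §13.2.
-/

set_option autoImplicit false

noncomputable section

open Function NumberField IsDedekindDomain Field Polynomial
open scoped NumberField ContRepresentation

namespace Literature.NumberTheory.EllipticCurves

namespace ZpExtension

open IwasawaAlgebra IwasawaAlgebra.EisensteinCoeff Literature.NumberTheory.GaloisRepresentations
open Literature.NumberTheory.GaloisRepresentations.DiscreteGaloisModule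
open Literature.NumberTheory.GaloisCohomology.Howard2004 Literature.NumberTheory.Automorphic

variable {K : Type} [Field K] [NumberField K] (E : WeierstrassCurve K) [E.IsElliptic] {p : ℕ} [hp : Fact p.Prime]
  (κ' : ZpExtension K p) {m : ℕ} (hm : 1 ≤ m)

set_option maxHeartbeats 800000 in
/-- **`#H²(K_w, gr_w(T/π^iT)) ≤ p^{p^s}`, uniformly in the level.**  `D` the curve's `π`-adic refinement datum, `Φ` an ordinary
datum at `w` with an adapted basis `P₀ ∈ Fil_w E[p^k]`, `Q₀` of `E[p^k]` at the host level `k = host i` (`i ≥ 1`): `Fil_w = ℤ P₀`,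
`E[p^k] = ℤ P₀ + ℤ Q₀`, and `g₀ ∈ Γ_{K_w}` acts by `g₀ Q₀ ≡ λ₂ Q₀ (mod Fil_w)`; `κ(g₀) = p^s` with `p^s < m`; `g₀` acts on `μ_{p^k}` by
the integer `c`, `p ∤ c`.  Then `H²(K_w, Level i ⧸ piFil i)` (the graded line, as the quotient representation) is finite of order
`≤ p^{p^s}`. [cite: Howard2004HeegnerKolyvagin, Lemma 3.2.7 (arXiv:1202.6340 p. 16 L150–156) and §3.1 (gr_v)]
[cite: MilneADT2006, Ch. I Cor. 2.3] [cite: GreenbergLNM1716, §2 and proof of Prop. 4.15] -/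
theorem _root_.WeierstrassCurve.natCard_two_piLevel_quotient_le
    {w : HeightOneSpectrum (𝓞 K)}
    (Φ : OrdinaryFiltration (fun j ↦ E.torsionGaloisModule ((p : ℤ) ^ j)) (fun j ↦ E.torsionGaloisModuleReduce p j) w)
    {i : ℕ} (hi : 1 ≤ i)
    (P₀ Q₀ : E.geomTorsion ((p : ℤ) ^ (E.eisensteinPiRefinementDatum κ' hm).host i))
    (hP₀ : P₀ ∈ Φ.fil ((E.eisensteinPiRefinementDatum κ' hm).host i))
    (hPQ : ∀ a : E.geomTorsion ((p : ℤ) ^ (E.eisensteinPiRefinementDatum κ' hm).host i), ∃ n₁ n₂ : ℤ, n₁ • P₀ + n₂ • Q₀ = a)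
    {g₀ : absoluteGaloisGroup (w.adicCompletion K)} {s : ℕ}
    (hg₀ : (κ' (absGaloisRestrict K (w.adicCompletion K) g₀)).toAdd = ((p ^ s : ℕ) : ℤ_[p])) (hms : p ^ s < m)
    (lam : ℤ) (hlam : E.torsionGaloisModule ((p : ℤ) ^ (E.eisensteinPiRefinementDatum κ' hm).host i)
      (absGaloisRestrict K (w.adicCompletion K) g₀) Q₀ - lam • Q₀ ∈ Φ.fil ((E.eisensteinPiRefinementDatum κ' hm).host i))
    (c : ℤ) (hc : ∀ ζ : MuCarrier (w.adicCompletion K) (p ^ (E.eisensteinPiRefinementDatum κ' hm).host i),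
      mu (w.adicCompletion K) (p ^ (E.eisensteinPiRefinementDatum κ' hm).host i) g₀ ζ = c • ζ)
    (hcp : ¬ (p : ℤ) ∣ c) :
    Finite (continuousCohomology 2 ((GaloisRep.toLocal w ((E.eisensteinPiRefinementDatum κ' hm).levelRep i)).quotient
        (E.piFil κ' hm Φ i) (E.piFil_le_comap κ' hm Φ i)).toTopRep) ∧
      Nat.card (continuousCohomology 2 ((GaloisRep.toLocal w ((E.eisensteinPiRefinementDatum κ' hm).levelRep i)).quotient
        (E.piFil κ' hm Φ i) (E.piFil_le_comap κ' hm Φ i)).toTopRep) ≤ p ^ (p ^ s) := by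
  classical
  haveI : CharZero (w.adicCompletion K) := charZero_of_injective_algebraMap (algebraMap K _).injective
  have hk : 1 ≤ (E.eisensteinPiRefinementDatum κ' hm).host i := by
    rw [WeierstrassCurve.eisensteinPiRefinementDatum_host]
    exact (Nat.le_div_iff_mul_le hm).mpr (by omega)
  haveI hfinE : Finite (E.geomTorsion ((p : ℤ) ^ (E.eisensteinPiRefinementDatum κ' hm).host i)) :=
    WeierstrassCurve.finite_torsionPoints_holds E (AlgebraicClosure K) (pow_ne_zero _ (by exact_mod_cast hp.out.ne_zero))
  haveI hfinN : Finite (EisensteinLevel p m (fun j ↦ E.geomTorsion ((p : ℤ) ^ j)) ((E.eisensteinPiRefinementDatum κ' hm).host i)) :=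
    EisensteinCoeff.finite_twisted (p := p) (k := (E.eisensteinPiRefinementDatum κ' hm).host i) hm
  haveI hfinL : Finite ((E.eisensteinPiRefinementDatum κ' hm).Level i) :=
    Finite.of_surjective _ (Submodule.Quotient.mk_surjective _)
  haveI hfinQ : Finite ((E.eisensteinPiRefinementDatum κ' hm).Level i ⧸ E.piFil κ' hm Φ i) :=
    Finite.of_surjective _ (Submodule.Quotient.mk_surjective _)
  -- the generators `t_P = 1 ⊗ P₀`, `t_Q = 1 ⊗ Q₀` at the host level, their classes in `Level i` and in the quotient
  let tP : EisensteinLevel p m (fun j ↦ E.geomTorsion ((p : ℤ) ^ j)) ((E.eisensteinPiRefinementDatum κ' hm).host i) :=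
    EisensteinCoeff.Twisted.tmul (1 : EisensteinCoeff p m ((E.eisensteinPiRefinementDatum κ' hm).host i)) P₀
  let tQ : EisensteinLevel p m (fun j ↦ E.geomTorsion ((p : ℤ) ^ j)) ((E.eisensteinPiRefinementDatum κ' hm).host i) :=
    EisensteinCoeff.Twisted.tmul (1 : EisensteinCoeff p m ((E.eisensteinPiRefinementDatum κ' hm).host i)) Q₀
  let xP : (E.eisensteinPiRefinementDatum κ' hm).Level i := Submodule.Quotient.mk tP
  let y₀ : (E.eisensteinPiRefinementDatum κ' hm).Level i := Submodule.Quotient.mk tQ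
  have htP : (tP : Twisted p m ((E.eisensteinPiRefinementDatum κ' hm).host i)
      (E.geomTorsion ((p : ℤ) ^ (E.eisensteinPiRefinementDatum κ' hm).host i))) ∈
        Φ.twistedFil (p := p) (m := m) ((E.eisensteinPiRefinementDatum κ' hm).host i) :=
    Φ.tmul_mem_twistedFil _ 1 hP₀
  have hxP : xP ∈ E.piFil κ' hm Φ i := (E.mem_piFil_iff κ' hm Φ i xP).mpr ⟨tP, htP, rfl⟩
  -- ### the `S_𝔮`-action preserves `piFil i`
  have hSmem : ∀ (a : IwasawaAlgebra p ⧸ Ideal.span {(PowerSeries.X ^ m + PowerSeries.C (p : ℤ_[p]) : IwasawaAlgebra p)})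
      (y : (E.eisensteinPiRefinementDatum κ' hm).Level i), y ∈ E.piFil κ' hm Φ i → a • y ∈ E.piFil κ' hm Φ i := by
    intro a y hy
    obtain ⟨f, rfl⟩ := Ideal.Quotient.mk_surjective a
    obtain ⟨z, hz, rfl⟩ := (E.mem_piFil_iff κ' hm Φ i y).mp hy
    rw [← Submodule.Quotient.mk_smul]
    refine (E.mem_piFil_iff κ' hm Φ i _).mpr ⟨_, ?_, rfl⟩
    rw [EisensteinLevel.quotient_mk_smul_def]
    exact Φ.smul_mem_twistedFil _ _ hz
  -- ### every element of `W_{m,k}` is `a₁ • (1 ⊗ P₀) + a₂ • (1 ⊗ Q₀)`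
  have hspan : ∀ z : Twisted p m ((E.eisensteinPiRefinementDatum κ' hm).host i)
      (E.geomTorsion ((p : ℤ) ^ (E.eisensteinPiRefinementDatum κ' hm).host i)),
      ∃ a₁ a₂ : EisensteinCoeff p m ((E.eisensteinPiRefinementDatum κ' hm).host i),
        a₁ • (EisensteinCoeff.Twisted.tmul (1 : EisensteinCoeff p m _) P₀ : Twisted p m _ _) +
          a₂ • (EisensteinCoeff.Twisted.tmul (1 : EisensteinCoeff p m _) Q₀ : Twisted p m _ _) = z := by
    intro z
    induction z using EisensteinCoeff.Twisted.induction_on with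
    | zero => exact ⟨0, 0, by rw [zero_smul, zero_smul, add_zero]⟩
    | tmul c' a =>
      obtain ⟨n₁, n₂, rfl⟩ := hPQ a
      refine ⟨n₁ • c', n₂ • c', ?_⟩
      rw [← Twisted.tmul_eq_smul_tmul_one, ← Twisted.tmul_eq_smul_tmul_one, Twisted.zsmul_tmul, Twisted.zsmul_tmul,
        ← Twisted.tmul_add]
    | add x y hx hy =>
      obtain ⟨a₁, a₂, rfl⟩ := hx
      obtain ⟨b₁, b₂, rfl⟩ := hy
      exact ⟨a₁ + b₁, a₂ + b₂, by rw [add_smul, add_smul]; abel⟩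
  -- ### the exponent of `g₀` at the host level is `p^s`
  have hJ : p ^ s < p ^ eisensteinLevel (p := p) hm ((E.eisensteinPiRefinementDatum κ' hm).host i) :=
    pow_lt_pow_eisensteinLevel hm hk hms
  have he : κ'.twistExponent (eisensteinLevel (p := p) hm ((E.eisensteinPiRefinementDatum κ' hm).host i))
      (absGaloisRestrict K (w.adicCompletion K) g₀) = p ^ s :=
    twistExponent_eq_of_toAdd_eq_natCast_pow κ' hJ hg₀
  -- ### the scalars: `μ = λ (1+T)^{p^s}`, `ν`, `π^{p^s}` as elements of `S_𝔮`
  let Sq := IwasawaAlgebra p ⧸ Ideal.span {(PowerSeries.X ^ m + PowerSeries.C (p : ℤ_[p]) : IwasawaAlgebra p)}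
  let mkS : IwasawaAlgebra p →+* Sq := Ideal.Quotient.mk _
  let mkA : IwasawaAlgebra p →+* EisensteinCoeff p m ((E.eisensteinPiRefinementDatum κ' hm).host i) := Ideal.Quotient.mk _
  have hSA : ∀ (f : IwasawaAlgebra p)
      (y : EisensteinLevel p m (fun j ↦ E.geomTorsion ((p : ℤ) ^ j)) ((E.eisensteinPiRefinementDatum κ' hm).host i)),
      mkS f • y = mkA f • y := fun f y ↦ EisensteinLevel.quotient_mk_smul_def _ f y
  let fμ : IwasawaAlgebra p := (lam : IwasawaAlgebra p) * ((1 : IwasawaAlgebra p) + PowerSeries.X) ^ (p ^ s)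
  obtain ⟨νA, hνA⟩ := exists_intCast_mul_onePlusT_pow_sub_intCast_mul_eq_mk_X_pow p
    ((E.eisensteinPiRefinementDatum κ' hm).host i) s hms lam c hcp
  obtain ⟨fν, hfν⟩ := Ideal.Quotient.mk_surjective νA
  have hmkA_fμ : mkA fμ = (lam : EisensteinCoeff p m _) * onePlusT p m _ ^ (p ^ s) := by
    simp only [mkA, fμ, map_mul, map_intCast, map_pow, onePlusT_def]
  have hA : mkA ((fμ - (c : IwasawaAlgebra p)) * fν) = mkA (PowerSeries.X ^ (p ^ s)) := by
    rw [map_mul, map_sub, map_intCast, hmkA_fμ]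
    change _ * (Ideal.Quotient.mk _ fν) = _
    rw [hfν, hνA]
    exact (map_pow mkA PowerSeries.X (p ^ s)).symm
  -- `((μ − c) ν) • y = π^{p^s} • y` on the host level module and on the `π`-adic level
  have hθνN : ∀ y : EisensteinLevel p m (fun j ↦ E.geomTorsion ((p : ℤ) ^ j)) ((E.eisensteinPiRefinementDatum κ' hm).host i),
      ((mkS fμ - (c : Sq)) * mkS fν) • y = mkS (PowerSeries.X ^ (p ^ s)) • y := by
    intro y
    have h1 : (mkS fμ - (c : Sq)) * mkS fν = mkS ((fμ - (c : IwasawaAlgebra p)) * fν) := by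
      rw [← map_intCast mkS c, ← map_sub, ← map_mul]
    rw [h1, hSA, hSA, hA]
  have hθν : ∀ y : (E.eisensteinPiRefinementDatum κ' hm).Level i,
      ((mkS fμ - (c : Sq)) * mkS fν) • y = mkS (PowerSeries.X ^ (p ^ s)) • y := by
    intro y
    induction y using Submodule.Quotient.induction_on with
    | _ y => rw [← Submodule.Quotient.mk_smul, ← Submodule.Quotient.mk_smul, hθνN]
  -- ### the action of `g₀` on `1 ⊗ Q₀`: `g₀ · (1 ⊗ Q₀) = μ₂ • (1 ⊗ Q₀) + (plus part)`
  have hρtQ : ∃ f : Twisted p m ((E.eisensteinPiRefinementDatum κ' hm).host i)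
      (E.geomTorsion ((p : ℤ) ^ (E.eisensteinPiRefinementDatum κ' hm).host i)),
      f ∈ Φ.twistedFil (p := p) (m := m) ((E.eisensteinPiRefinementDatum κ' hm).host i) ∧
      κ'.eisensteinTwist (E.torsionGaloisModule ((p : ℤ) ^ (E.eisensteinPiRefinementDatum κ' hm).host i)) hm
        ((E.eisensteinPiRefinementDatum κ' hm).host i) (absGaloisRestrict K (w.adicCompletion K) g₀)
        (Twisted.tmul (1 : EisensteinCoeff p m ((E.eisensteinPiRefinementDatum κ' hm).host i)) Q₀) =
      ((lam : EisensteinCoeff p m ((E.eisensteinPiRefinementDatum κ' hm).host i)) *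
          onePlusT p m ((E.eisensteinPiRefinementDatum κ' hm).host i) ^ (p ^ s)) •
        (Twisted.tmul (1 : EisensteinCoeff p m ((E.eisensteinPiRefinementDatum κ' hm).host i)) Q₀ :
          Twisted p m ((E.eisensteinPiRefinementDatum κ' hm).host i)
            (E.geomTorsion ((p : ℤ) ^ (E.eisensteinPiRefinementDatum κ' hm).host i))) + f := by
    refine ⟨Twisted.tmul (onePlusT p m ((E.eisensteinPiRefinementDatum κ' hm).host i) ^ (p ^ s))
      (E.torsionGaloisModule ((p : ℤ) ^ (E.eisensteinPiRefinementDatum κ' hm).host i)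
        (absGaloisRestrict K (w.adicCompletion K) g₀) Q₀ - lam • Q₀), Φ.tmul_mem_twistedFil _ _ hlam, ?_⟩
    rw [κ'.eisensteinTwist_apply_tmul, he, mul_one, Twisted.tmul_sub, ← Twisted.zsmul_tmul, Twisted.smul_tmul, mul_one,
      zsmul_eq_mul]
    abel
  have hτy₀ : ∃ f' ∈ E.piFil κ' hm Φ i,
      GaloisRep.toLocal w ((E.eisensteinPiRefinementDatum κ' hm).levelRep i) g₀ y₀ = mkS fμ • y₀ + f' := by
    obtain ⟨f, hf, hρ⟩ := hρtQ
    refine ⟨Submodule.Quotient.mk (f : EisensteinLevel p m (fun j ↦ E.geomTorsion ((p : ℤ) ^ j)) _),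
      (E.mem_piFil_iff κ' hm Φ i _).mpr ⟨_, hf, rfl⟩, ?_⟩
    change GaloisRep.toLocal w ((E.eisensteinPiRefinementDatum κ' hm).levelRep i) g₀ (Submodule.Quotient.mk tQ) =
      mkS fμ • Submodule.Quotient.mk tQ + _
    rw [GaloisRep.toLocal_apply, PiRefinementDatum.levelRep_apply_mk, ← Submodule.Quotient.mk_smul, hSA, hmkA_fμ,
      ← Submodule.Quotient.mk_add]
    exact congrArg _ hρ
  have hlin : ∀ (σ : absoluteGaloisGroup K) (a : Sq) (y : (E.eisensteinPiRefinementDatum κ' hm).Level i),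
      (E.eisensteinPiRefinementDatum κ' hm).levelRep i σ (a • y) = a • (E.eisensteinPiRefinementDatum κ' hm).levelRep i σ y :=
    (E.eisensteinPiRefinementDatum κ' hm).isScalarLinear_levelRep i
  -- ### the quotient representation `X' = Level i ⧸ piFil i`, killed by `p^k`
  have hMq : ∀ x : (E.eisensteinPiRefinementDatum κ' hm).Level i ⧸ E.piFil κ' hm Φ i,
      p ^ ((E.eisensteinPiRefinementDatum κ' hm).host i) • x = 0 := by
    intro x
    induction x using Submodule.Quotient.induction_on with
    | _ x =>
      obtain ⟨y, rfl⟩ := Submodule.Quotient.mk_surjective _ x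
      have h0 : p ^ ((E.eisensteinPiRefinementDatum κ' hm).host i) • y = 0 :=
        EisensteinCoeff.prime_pow_nsmul_twisted (p := p) (m := m)
          (y : Twisted p m _ (E.geomTorsion ((p : ℤ) ^ (E.eisensteinPiRefinementDatum κ' hm).host i)))
      have h1 : ((p ^ ((E.eisensteinPiRefinementDatum κ' hm).host i) : ℕ) : Sq) •
          (Submodule.Quotient.mk y : (E.eisensteinPiRefinementDatum κ' hm).Level i) = 0 := by
        rw [← Submodule.Quotient.mk_smul, Nat.cast_smul_eq_nsmul, h0, Submodule.Quotient.mk_zero]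
      change p ^ ((E.eisensteinPiRefinementDatum κ' hm).host i) •
          (E.piFil κ' hm Φ i).mkQ (Submodule.Quotient.mk y : (E.eisensteinPiRefinementDatum κ' hm).Level i) = 0
      rw [← map_nsmul, ← Nat.cast_smul_eq_nsmul Sq, h1, map_zero]
  -- ### the coordinate map `q : S_𝔮 → Level i ⧸ piFil i`, `a ↦ [a • y₀]`, onto
  let q : Sq →+ (E.eisensteinPiRefinementDatum κ' hm).Level i ⧸ E.piFil κ' hm Φ i :=
    AddMonoidHom.mk' (fun a ↦ Submodule.Quotient.mk (a • y₀)) (fun a b ↦ by rw [add_smul, Submodule.Quotient.mk_add])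
  have hq : ∀ a : Sq, q a = Submodule.Quotient.mk (a • y₀) := fun _ ↦ rfl
  have hqsurj : Surjective q := by
    intro x
    induction x using Submodule.Quotient.induction_on with
    | _ x =>
      obtain ⟨z, rfl⟩ := Submodule.Quotient.mk_surjective _ x
      obtain ⟨a₁, a₂, hz⟩ := hspan (z : Twisted p m _ (E.geomTorsion ((p : ℤ) ^ (E.eisensteinPiRefinementDatum κ' hm).host i)))
      obtain ⟨f₁, rfl⟩ := Ideal.Quotient.mk_surjective a₁
      obtain ⟨f₂, rfl⟩ := Ideal.Quotient.mk_surjective a₂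
      refine ⟨mkS f₂, ?_⟩
      rw [hq, Submodule.Quotient.eq]
      -- `f₂ • y₀ − [z] = −(f₁ • xP) ∈ piFil`
      have hzL : (Submodule.Quotient.mk z : (E.eisensteinPiRefinementDatum κ' hm).Level i) = mkS f₁ • xP + mkS f₂ • y₀ := by
        change _ = mkS f₁ • Submodule.Quotient.mk tP + mkS f₂ • Submodule.Quotient.mk tQ
        rw [← Submodule.Quotient.mk_smul, ← Submodule.Quotient.mk_smul, ← Submodule.Quotient.mk_add, hSA, hSA]
        exact congrArg _ hz.symm
      rw [hzL]
      have hring : mkS f₂ • y₀ - (mkS f₁ • xP + mkS f₂ • y₀) = -(mkS f₁ • xP) := by abel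
      rw [hring]
      exact (E.piFil κ' hm Φ i).neg_mem (hSmem _ _ hxP)
  -- ### `R = π^{p^s} · gr` and the eigen-cochain identity
  let I : Ideal Sq := Ideal.span {mkS (PowerSeries.X ^ (p ^ s))}
  let R : AddSubgroup ((E.eisensteinPiRefinementDatum κ' hm).Level i ⧸ E.piFil κ' hm Φ i) := I.toAddSubgroup.map q
  have hR : ∀ r ∈ R, ∃ v : (E.eisensteinPiRefinementDatum κ' hm).Level i ⧸ E.piFil κ' hm Φ i,
      (GaloisRep.toLocal w ((E.eisensteinPiRefinementDatum κ' hm).levelRep i)).quotient (E.piFil κ' hm Φ i)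
        (E.piFil_le_comap κ' hm Φ i) g₀ v - c • v = r := by
    rintro _ ⟨a, ha, rfl⟩
    obtain ⟨b, rfl⟩ := Ideal.mem_span_singleton'.mp ha
    obtain ⟨f', hf', hτ⟩ := hτy₀
    refine ⟨q (b * mkS fν), ?_⟩
    rw [hq, hq, ContinuousRep.quotient_apply_mk, GaloisRep.toLocal_apply, hlin, ← GaloisRep.toLocal_apply, hτ, smul_add,
      Submodule.Quotient.mk_add, (Submodule.Quotient.mk_eq_zero _).mpr (hSmem _ _ hf'), add_zero]
    change (E.piFil κ' hm Φ i).mkQ _ - c • (E.piFil κ' hm Φ i).mkQ _ = (E.piFil κ' hm Φ i).mkQ _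
    rw [← map_zsmul, ← map_sub]
    congr 1
    calc (b * mkS fν) • mkS fμ • y₀ - c • (b * mkS fν) • y₀
        = (b * mkS fν * mkS fμ) • y₀ - ((c : Sq) * (b * mkS fν)) • y₀ := by
          rw [mul_smul (b * mkS fν) (mkS fμ) y₀, mul_smul (c : Sq) (b * mkS fν) y₀, Int.cast_smul_eq_zsmul]
      _ = (b * ((mkS fμ - (c : Sq)) * mkS fν)) • y₀ :=
          (sub_smul (b * mkS fν * mkS fμ) ((c : Sq) * (b * mkS fν)) y₀).symm.trans (congrArg (· • y₀) (by ring))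
      _ = (b * mkS (PowerSeries.X ^ (p ^ s))) • y₀ :=
          (mul_smul b _ y₀).trans ((congrArg (b • ·) (hθν y₀)).trans (mul_smul b _ y₀).symm)
  -- ### local duality + the count
  obtain ⟨hfin, hle⟩ := natCard_two_le_natCard_quotient_of_mu_apply_eq_smul (w.adicCompletion K)
    ((GaloisRep.toLocal w ((E.eisensteinPiRefinementDatum κ' hm).levelRep i)).quotient (E.piFil κ' hm Φ i)
      (E.piFil_le_comap κ' hm Φ i)) hMq g₀ c hc R hR
  refine ⟨hfin, hle.trans ?_⟩
  have hcardS : Nat.card (Sq ⧸ I) = p ^ (p ^ s) := natCard_quotient_span_mk_X_pow_eq p hms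
  haveI : Finite (Sq ⧸ I) := Nat.finite_of_card_ne_zero (by rw [hcardS]; exact pow_ne_zero _ hp.out.ne_zero)
  have hfinI : Finite (Sq ⧸ I.toAddSubgroup) := ‹Finite (Sq ⧸ I)›
  let qbar : Sq ⧸ I.toAddSubgroup →+ ((E.eisensteinPiRefinementDatum κ' hm).Level i ⧸ E.piFil κ' hm Φ i) ⧸ R :=
    QuotientAddGroup.map _ R q (fun a ha ↦ AddSubgroup.mem_map_of_mem q ha)
  have hqbar : Surjective qbar := by
    intro y
    induction y using QuotientAddGroup.induction_on with
    | H x =>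
      obtain ⟨a, rfl⟩ := hqsurj x
      exact ⟨QuotientAddGroup.mk a, by rw [QuotientAddGroup.map_mk]⟩
  calc Nat.card (((E.eisensteinPiRefinementDatum κ' hm).Level i ⧸ E.piFil κ' hm Φ i) ⧸ R)
      ≤ Nat.card (Sq ⧸ I.toAddSubgroup) := Nat.card_le_card_of_surjective qbar hqbar
    _ = Nat.card (Sq ⧸ I) := rfl
    _ = p ^ (p ^ s) := hcardS

end ZpExtension

end Literature.NumberTheory.EllipticCurves
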